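import Literature.MathematicalPhysics.QuantumLattice.HubbardTTPrimeMeanEnergySupergradient
import HarnessLib

/-!
# Sourced cuts: LP weak duality over a cap, ordinary cuts and SOURCED cuts (one extra word
# coordinate), and the eom-free window certificate that feeds a sourced cut to every torus-limit state

Family `hubbard` (topic `MathematicalPhysics/QuantumLattice`; companion of `HubbardTTPrimeCapCutDualRows`).
Written for the certified fast layer of the Hubbard re-charter (crew hubbard-fast, planner-p1 RULING R-10,
sketch "L-9" `SourcedCuts.lean` sha256 91257198…, 2026-08-25): for a fixed window word `W` (a two-body
correlator: spin–spin, pair, density–density) write `w` for its per-site value in the state `ω`. A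
*sourced cut* at anchor `k` is a certified lower bound `ℓ^W_k ≤ e_{Φ(t,t'_k,U_k)}(ω) + V_k · w` valid for
the query state; LP weak duality over the cap, the ordinary cuts and the sourced cuts
(`capCutsWord_dual_le`, §1 — statements and proofs verbatim from the crew's checked sketch) bounds the
combination, and when the multipliers cancel the three energy coordinates it is a program-free bound on
`w` (`word_bound_of_capCutsWord`). §2 is the model-specific FEEDING lemma, in the only variant that is a
state-independent row without new thermodynamic-limit theory: an **eom-free** window certificate at the
anchor couplings `(t'_k, U_k)` — Gram positivity, translation/charged-word nulls, density rows, NO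
`[H, B]` rows and no energy cap — with objective `V•W + E_{Φ(t,t'_k,U_k)}` bounds
`V·Re ω(W) + e_{Φ(t,t'_k,U_k)}(ω)` below for EVERY torus limit `ω` of unit `(rectN n, S^z = 0)` sector
ground states at ANY coupling `(t', U)` (`IsTorusLimitOf.sourcedCut_of_window_certificate_TT'_ineq`:
the tree's `re_expect_ge_of_window_certificate_TT'_ineq` at the query coupling with empty eom family and
`κ = 0`, plus linearity and the isotony of the state). Certificates that use the eom rows of the
UNSOURCED `H(t'_k,U_k)` bound `e_Φ + V w` only over `H(t'_k,U_k)`-stationary states and are NOT fed by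
this lemma (they are node brackets, not transport rows); certificates with the eom rows of the SOURCED
Hamiltonian would need the thermodynamic-limit ground-state energy density of the sourced family, not in
the tree. §3 is the `D₄`-reduced form: point-group-reduced
certificates (symmetry labels `γₗ ∈ S ⊆ D₄`) feed the sourced cut with the `S`-ORBIT-MEAN word
(`IsTorusLimitOf.sourcedCut_of_window_certificate_d4_TT'_ineq`), the energy part being the same on every rotated
copy (`IsTorusLimitOf.re_expect_d4Emb_meanEnergyObs`, `torusAvgExpect_d4Emb_hubbardTTPrime_meanEnergyObs`).
§4 is the **two-sided barycentric bracket** of planner-p1 RULING R-12 (1) (sketch "L-10"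
`TwoSidedSourcing.lean` sha256 9c234428868fed1e…, statements and proofs verbatim): at a QUERY coupling
`θ* = (t', U) = Σ_k w_k θ_k` (weights `w_k ≥ 0`, `Σ w_k = 1`) in the convex hull of cell corners
`θ_k = (t'_k, U_k)` carrying sourced cuts `ℓ⁺_k ≤ e_{Φ(t,θ_k)}(ω) + V₀·w` and
`ℓ⁻_k ≤ e_{Φ(t,θ_k)}(ω) − V₀·w` (`V₀ > 0`), ONE cap `e_{Φ(t,θ*)}(ω) ≤ u*` gives
`(Σ_k w_k ℓ⁺_k − u*)/V₀ ≤ w ≤ (u* − Σ_k w_k ℓ⁻_k)/V₀`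
(`word_ge/le/mem_Icc_of_sourcedCuts_barycentric` = `word_bound_of_capCutsWord` with `A = ∅`, `κ = 1`,
`μ_k = w_k`, `V_k = ±V₀`), for every state satisfying the cap and the cuts. §5 is the exact bookkeeping
identity behind R-12 (1) — (interior two-sided width) − Σ_k w_k (corner `k`'s own width with its own cap
`u_k`) `= 2(u* − Σ_k w_k u_k)/V₀` (`twoSided_width_sub_mean_corner_width`; the sourced certificates cancel,
the price of transport is the cap defect alone) — and the sign of that defect when all caps are values of
ONE concave majorant, a pointwise minimum of finitely many affine functions of the couplings:
`Σ_k w_k u_k ≤ u*` (`sum_wgt_inf'_affine_le_inf'_affine_barycentre`).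
Everything is PROVED; no definition, no named fact.

## Mathlib / tree search

REUSED: `InfVolFermionState.meanEnergy_hubbardTTPrime_affine/_smul` (the coordinate form
`meanEnergy_hubbardTTPrime_eq_coords` of `HubbardTTPrimeCapCutDualRows` §1 is re-derived privately here so
that this module depends only on `HubbardTTPrimeMeanEnergySupergradient`),
`IsTorusLimitOf.re_expect_ge_of_window_certificate_TT'_ineq` (`HubbardNNNHoppingTorusLimitCorrelator`),
`InfVolFermionState.compatible`, `InfVolFermionState.meanEnergy` (definition); for §3
`IsTorusLimitOf.re_sum_expect_d4_ge_of_window_certificate_TT'_ineq`, `torusAvgExpect_hubbardTTPrime_meanEnergyObs`,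
`eventually_injOn_proj_of_tendsto` (`HubbardNNNHoppingTorusLimitCorrelator`), `fermionEmbed_toTorusEmb_d4Emb`
(`HubbardWindowCertificateD4`), `relabel_d4Perm_hubbardTorusTT'` (`HubbardNNNHoppingWindowCertificateD4`),
`Orb.d4Perm_mul_translate` (`HubbardNNNHoppingCorrelatorCertificate`), `sum_relabel_translate_hubbardTTPrime_meanEnergyObs`
(`HubbardNNNHoppingInteractionTorus`), `expect_fockRelabel_mulVec`, `relabel_trans/_refl/_sum`, `d4SitePerm`,
`d4Site_apply_inv`, `Orb.translate_zero/_neg` (`FockRelabel`), `injOn_proj_thicken_one`.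
`lean search 'capCutsWord|sourced' --decl`: nothing.

## References

* D. P. Bertsekas, *Nonlinear Programming*, 2nd ed. (1999), Prop. 5.1.3 (weak duality, pointwise form)
  [cite: Bertsekas1999NonlinearProgramming, Prop. 5.1.3]; Appendix B, Prop. B.2(d) (a pointwise supremum
  of convex functions is convex — used in §5 in the form: a minimum of affine functions is concave)
  [cite: Bertsekas1999NonlinearProgramming, Prop. B.2(d)].
* R. B. Griffiths, J. Math. Phys. 5 (1964) 1215, §II (concavity / secant bounds). [cite: Griffiths1964, §II]
* T. Koma, H. Tasaki, J. Stat. Phys. 76 (1994) 745, §1. [cite: KomaTasaki1994, §1]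
* J. Wang et al., PRX 14 (2024) 031006, §III (moment-relaxation certificates with linear objectives; an
  observable shifted by the energy). [cite: WangEtAl2024, §III]
* X. Han, arXiv:2006.06002 (2020), §3 (translation-invariant many-body bootstrap). [cite: Han2020Bootstrap, §3]
-/

noncomputable section

namespace Literature.MathematicalPhysics.QuantumLattice

open Matrix Finset HubbardWave0 Literature.Probability.LatticeModels ThermodynamicLimit
open Literature.MathematicalPhysics.QuantumManyBody.StateRelaxation
open _root_.Filter
open scoped _root_.Topology ComplexOrder BigOperators

namespace InfVolFermionState

/-! ### §1 LP weak duality with sourced cuts (every state) -/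

/-- Coordinate form of the mean energy (private copy of `meanEnergy_hubbardTTPrime_eq_coords`):
`e_{Φ(t,t',U)}(ω) = t·K₁(ω) + t'·K₂(ω) + U·D(ω)`. [cite: BratteliKishimotoRobinson1978, §3 (mean energy functional)] -/
private theorem meanEnergy_coords (ω : InfVolFermionState 2) (t t' U : ℝ) :
    ω.meanEnergy (hubbardTTPrimeFermionInteraction t t' U) 1 =
      t * ω.meanEnergy (hubbardTTPrimeFermionInteraction 1 0 0) 1 +
        t' * ω.meanEnergy (hubbardTTPrimeFermionInteraction 0 1 0) 1 +
          U * ω.meanEnergy (hubbardTTPrimeFermionInteraction 0 0 1) 1 := by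
  have h0 : ω.meanEnergy (hubbardTTPrimeFermionInteraction t 0 0) 1 =
      t * ω.meanEnergy (hubbardTTPrimeFermionInteraction 1 0 0) 1 := by
    have h := ω.meanEnergy_hubbardTTPrime_smul t 1 0 0
    rwa [mul_one, mul_zero] at h
  rw [ω.meanEnergy_hubbardTTPrime_affine t 0 0 t' U, h0, sub_zero, sub_zero]
  ring

/-- **Cap + cuts + sourced cuts dual row, every state** (one extra word coordinate `w`).
LP weak duality; no ground-state hypothesis. [cite: Bertsekas1999NonlinearProgramming, Prop. 5.1.3] -/
theorem capCutsWord_dual_le (ω : InfVolFermionState 2) (t : ℝ) {ι : Type*} (A : Finset ι)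
    (tp Uc lo lam : ι → ℝ) (hlam : ∀ k ∈ A, 0 ≤ lam k)
    (hcut : ∀ k ∈ A, lo k ≤ ω.meanEnergy (hubbardTTPrimeFermionInteraction t (tp k) (Uc k)) 1)
    {ι' : Type*} (B : Finset ι') (tpW UcW V loW mu : ι' → ℝ) (hmu : ∀ k ∈ B, 0 ≤ mu k) (w : ℝ)
    (hcutW : ∀ k ∈ B,
      loW k ≤ ω.meanEnergy (hubbardTTPrimeFermionInteraction t (tpW k) (UcW k)) 1 + V k * w)
    {κ u t' U : ℝ} (hκ : 0 ≤ κ)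
    (hcap : ω.meanEnergy (hubbardTTPrimeFermionInteraction t t' U) 1 ≤ u) :
    (κ * t - ∑ k ∈ A, lam k * t - ∑ k ∈ B, mu k * t) *
          ω.meanEnergy (hubbardTTPrimeFermionInteraction 1 0 0) 1 +
        (κ * t' - ∑ k ∈ A, lam k * tp k - ∑ k ∈ B, mu k * tpW k) *
          ω.meanEnergy (hubbardTTPrimeFermionInteraction 0 1 0) 1 +
        (κ * U - ∑ k ∈ A, lam k * Uc k - ∑ k ∈ B, mu k * UcW k) *
          ω.meanEnergy (hubbardTTPrimeFermionInteraction 0 0 1) 1 -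
        (∑ k ∈ B, mu k * V k) * w ≤
      κ * u - ∑ k ∈ A, lam k * lo k - ∑ k ∈ B, mu k * loW k := by
  set K₁ := ω.meanEnergy (hubbardTTPrimeFermionInteraction 1 0 0) 1 with hK₁
  set K₂ := ω.meanEnergy (hubbardTTPrimeFermionInteraction 0 1 0) 1 with hK₂
  set D := ω.meanEnergy (hubbardTTPrimeFermionInteraction 0 0 1) 1 with hD
  have hcap' : κ * (t * K₁ + t' * K₂ + U * D) ≤ κ * u := by
    rw [← ω.meanEnergy_coords t t' U]
    exact mul_le_mul_of_nonneg_left hcap hκ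
  have hcutA : ∑ k ∈ A, lam k * lo k ≤ ∑ k ∈ A, lam k * (t * K₁ + tp k * K₂ + Uc k * D) := by
    refine Finset.sum_le_sum fun k hk => ?_
    rw [← ω.meanEnergy_coords t (tp k) (Uc k)]
    exact mul_le_mul_of_nonneg_left (hcut k hk) (hlam k hk)
  have hcutB : ∑ k ∈ B, mu k * loW k ≤
      ∑ k ∈ B, mu k * (t * K₁ + tpW k * K₂ + UcW k * D + V k * w) := by
    refine Finset.sum_le_sum fun k hk => ?_
    rw [← ω.meanEnergy_coords t (tpW k) (UcW k)]
    exact mul_le_mul_of_nonneg_left (hcutW k hk) (hmu k hk)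
  have hsA : ∑ k ∈ A, lam k * (t * K₁ + tp k * K₂ + Uc k * D) =
      (∑ k ∈ A, lam k * t) * K₁ + (∑ k ∈ A, lam k * tp k) * K₂ + (∑ k ∈ A, lam k * Uc k) * D := by
    rw [Finset.sum_mul, Finset.sum_mul, Finset.sum_mul, ← Finset.sum_add_distrib,
      ← Finset.sum_add_distrib]
    exact Finset.sum_congr rfl fun k _ => by ring
  have hsB : ∑ k ∈ B, mu k * (t * K₁ + tpW k * K₂ + UcW k * D + V k * w) =
      (∑ k ∈ B, mu k * t) * K₁ + (∑ k ∈ B, mu k * tpW k) * K₂ + (∑ k ∈ B, mu k * UcW k) * D +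
        (∑ k ∈ B, mu k * V k) * w := by
    rw [Finset.sum_mul, Finset.sum_mul, Finset.sum_mul, Finset.sum_mul, ← Finset.sum_add_distrib,
      ← Finset.sum_add_distrib, ← Finset.sum_add_distrib]
    exact Finset.sum_congr rfl fun k _ => by ring
  rw [hsA] at hcutA
  rw [hsB] at hcutB
  nlinarith [hcap', hcutA, hcutB]

/-- **Program-free two-sided word bound** (the 0b-W row read as a bound on `w`): if the multipliers
cancel the three energy coordinates and `c := Σ_B μ_k V_k`, then `−c · w ≤ κu − Σλℓ − Σμℓ^W`; with
`c < 0` this is an upper bound on `w`, with `c > 0` a lower bound.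
[cite: Bertsekas1999NonlinearProgramming, Prop. 5.1.3] [cite: KomaTasaki1994, §1] -/
theorem word_bound_of_capCutsWord (ω : InfVolFermionState 2) (t : ℝ) {ι : Type*} (A : Finset ι)
    (tp Uc lo lam : ι → ℝ) (hlam : ∀ k ∈ A, 0 ≤ lam k)
    (hcut : ∀ k ∈ A, lo k ≤ ω.meanEnergy (hubbardTTPrimeFermionInteraction t (tp k) (Uc k)) 1)
    {ι' : Type*} (B : Finset ι') (tpW UcW V loW mu : ι' → ℝ) (hmu : ∀ k ∈ B, 0 ≤ mu k) (w : ℝ)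
    (hcutW : ∀ k ∈ B,
      loW k ≤ ω.meanEnergy (hubbardTTPrimeFermionInteraction t (tpW k) (UcW k)) 1 + V k * w)
    {κ u t' U : ℝ} (hκ : 0 ≤ κ)
    (hcap : ω.meanEnergy (hubbardTTPrimeFermionInteraction t t' U) 1 ≤ u)
    (h1 : κ * t - ∑ k ∈ A, lam k * t - ∑ k ∈ B, mu k * t = 0)
    (h2 : κ * t' - ∑ k ∈ A, lam k * tp k - ∑ k ∈ B, mu k * tpW k = 0)
    (h3 : κ * U - ∑ k ∈ A, lam k * Uc k - ∑ k ∈ B, mu k * UcW k = 0) :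
    -(∑ k ∈ B, mu k * V k) * w ≤ κ * u - ∑ k ∈ A, lam k * lo k - ∑ k ∈ B, mu k * loW k := by
  have h := ω.capCutsWord_dual_le t A tp Uc lo lam hlam hcut B tpW UcW V loW mu hmu w hcutW hκ hcap
  rw [h1, h2, h3] at h
  linarith

/-! ### §2 Feeding a sourced cut: the eom-free window certificate (every torus-limit sector ground state,
at any coupling) -/

/-- **Eom-free sourced window certificate ⇒ sourced cut for the query state.** Let `ω` be a torus limit
along `Ls → ∞` of unit `(rectN n (Ls j), S^z = 0)` sector ground states of `hubbardTorusTT' (Ls j) t t' U`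
(`U ≥ 0`, `0 ≤ n < 2`; the QUERY coupling — the certificate below does not mention it). Suppose a window
identity in `𝔄_{Λ'}` with objective the sourced anchor energy
`X = V•W + Γ(E_{Φ(t, t'ₖ, Uₖ)})` (`W ∈ 𝔄_{Λ'}` any word, `(t'ₖ, Uₖ)` any anchor couplings, `V` real):
`X − c·1 − Σ_σ μ_σ (n_{0σ} − ν) = Σ Λmᵢⱼ Oᵢ⋆Oⱼ + (translation nulls) + (charged words) + Σ d (Vᴴ − V) + Σ aₖ vₖ`
with `Λm ⪰ 0` and NO equation-of-motion rows and NO energy cap. Then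
`c − Σₖ‖aₖ‖ + (Σ_σ μ_σ)(n/2 − ν) ≤ V · Re ω_{Λ'}(W) + e_{Φ(t,t'ₖ,Uₖ)}(ω)` — the hypothesis `hcutW` of
`capCutsWord_dual_le` with `loW = c − Σ‖a‖ + (Σμ)(n/2 − ν)` and `w = Re ω_{Λ'}(W)`. (The tree's
`re_expect_ge_of_window_certificate_TT'_ineq` at the query coupling with `s = ∅`, `κ = 0`; then
linearity of `ω_{Λ'}` and isotony `ω_{Λ'}(Γ E) = ω(E)`.) [cite: WangEtAl2024, §III] -/
theorem IsTorusLimitOf.sourcedCut_of_window_certificate_TT'_ineq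
    (t t' : ℝ) {U : ℝ} (hU : 0 ≤ U) {n : ℝ} (hn0 : 0 ≤ n) (hn2 : n < 2) (tpk Uk V : ℝ)
    {Λ Λ' : Finset (Site 2)} (hΛ : Λ ⊆ Λ') (h8 : thicken Λ 1 ⊆ Λ')
    (h0 : thicken ({0} : Finset (Site 2)) 1 ⊆ Λ') (hz : (0 : Site 2) ∈ Λ')
    (W : FermionOp Λ') (μ : Fin 2 → ℝ) (ν : ℝ)
    {m : Type*} [Fintype m] [DecidableEq m] {Λm : Matrix m m ℂ} (hΛm : Λm.PosSemidef)
    (O : m → FermionOp Λ')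
    {ι : Type*} (tt : Finset ι) (wv : ι → Site 2)
    (hsh : ∀ l, d4ShiftSet (1 : DihedralGroup 4) (wv l) Λ ⊆ Λ') (Y : ι → FermionOp Λ)
    {ρ : Type*} (uu : Finset ρ) (b : ρ → ℂ) (cw : ρ → List (Orb (PolySite Λ') × Bool))
    (hcw : ∀ j ∈ uu, ladderCharge (cw j) ≠ 0 ∨ ladderSpinCharge (cw j) ≠ 0)
    {δ : Type*} (ah : Finset δ) (dc : δ → ℝ) (Vh : δ → FermionOp Λ')
    {κ'' : Type*} (w : Finset κ'') (a : κ'' → ℂ) (word : κ'' → List (Orb (PolySite Λ') × Bool)) {c : ℝ}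
    (hcert : (((V : ℝ) : ℂ) • W +
          fermionEmbed (PolySite.incl h0) ((hubbardTTPrimeFermionInteraction t tpk Uk).meanEnergyObs 1)) -
        (c : ℂ) • (1 : FermionOp Λ') -
        ∑ σ : Fin 2, ((μ σ : ℝ) : ℂ) • (nAt 0 hz σ - ((ν : ℝ) : ℂ) • (1 : FermionOp Λ')) =
      gramForm Λm O +
        (∑ l ∈ tt, (fermionEmbed (PolySite.incl (hsh l))
            (fermionEmbed (PolySite.d4Emb (1 : DihedralGroup 4) (wv l) Λ) (Y l)) -
            fermionEmbed (PolySite.incl hΛ) (Y l)) +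
          ∑ j ∈ uu, b j • ladderWord (cw j)) +
        (∑ m' ∈ ah, ((dc m' : ℝ) : ℂ) • ((Vh m')ᴴ - Vh m') + ∑ k ∈ w, a k • ladderWord (word k)))
    {Ls : ℕ → ℕ} (hLs : Tendsto Ls atTop atTop)
    {ψ : ∀ L, Fock (Orb (FermionTorus 2 L))}
    (hψ : ∀ j, IsGroundStateInSector (hubbardTorusTT' (Ls j) t t' U)
      (ThermodynamicLimit.rectN n (Ls j)) 0 (ψ (Ls j)))
    (hψ1 : ∀ j, star (ψ (Ls j)) ⬝ᵥ ψ (Ls j) = 1)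
    {ω : InfVolFermionState 2} (hω : ω.IsTorusLimitOf ψ Ls) :
    c - ∑ k ∈ w, ‖a k‖ + (∑ σ : Fin 2, μ σ) * (n / 2 - ν) ≤
      V * (ω.expect Λ' W).re + ω.meanEnergy (hubbardTTPrimeFermionInteraction t tpk Uk) 1 := by
  set Xw : FermionOp Λ' := ((V : ℝ) : ℂ) • W +
    fermionEmbed (PolySite.incl h0) ((hubbardTTPrimeFermionInteraction t tpk Uk).meanEnergyObs 1) with hXw
  -- the same identity in the shape of the tree theorem: empty eom family, `κ = 0`, cap `u := e`
  have hcert' : Xw - (c : ℂ) • (1 : FermionOp Λ') -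
      ∑ σ : Fin 2, ((μ σ : ℝ) : ℂ) • (nAt 0 hz σ - ((ν : ℝ) : ℂ) • (1 : FermionOp Λ')) -
      (((0 : ℝ) : ℝ) : ℂ) • ((((ThermodynamicLimit.energyDensityTT' t t' U n : ℝ)) : ℂ) • (1 : FermionOp Λ') -
        fermionEmbed (PolySite.incl h0) ((hubbardTTPrimeFermionInteraction t t' U).meanEnergyObs 1)) =
      gramForm Λm O +
        (∑ k ∈ (∅ : Finset Unit), ((hubbardTTPrimeFermionInteraction t t' U).localHamiltonian Λ' *
            fermionEmbed (PolySite.incl hΛ) ((fun _ : Unit => (0 : FermionOp Λ)) k) -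
            fermionEmbed (PolySite.incl hΛ) ((fun _ : Unit => (0 : FermionOp Λ)) k) *
              (hubbardTTPrimeFermionInteraction t t' U).localHamiltonian Λ') +
          ∑ l ∈ tt, (fermionEmbed (PolySite.incl (hsh l))
            (fermionEmbed (PolySite.d4Emb ((fun _ : ι => (1 : DihedralGroup 4)) l) (wv l) Λ) (Y l)) -
            fermionEmbed (PolySite.incl hΛ) (Y l)) +
          ∑ j ∈ uu, b j • ladderWord (cw j)) +
        (∑ m' ∈ ah, ((dc m' : ℝ) : ℂ) • ((Vh m')ᴴ - Vh m') + ∑ k ∈ w, a k • ladderWord (word k)) := by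
    rw [Finset.sum_empty, zero_add, Complex.ofReal_zero, zero_smul, sub_zero]
    exact hcert
  have h := hω.re_expect_ge_of_window_certificate_TT'_ineq t t' hU hn0 hn2 (le_refl (0 : ℝ))
    (le_refl (ThermodynamicLimit.energyDensityTT' t t' U n)) hΛ h8 h0 hz Xw μ ν hΛm O
    (∅ : Finset Unit) (fun _ : Unit => (0 : FermionOp Λ)) tt (fun _ : ι => (1 : DihedralGroup 4))
    (fun _ _ => rfl) wv hsh Y uu b cw hcw ah dc Vh w a word hcert' hLs hψ hψ1
  -- read the objective: `Re ω(V•W + Γ E) = V·Re ω(W) + e_Φ(ω)`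
  have hre : (ω.expect Λ' Xw).re =
      V * (ω.expect Λ' W).re + ω.meanEnergy (hubbardTTPrimeFermionInteraction t tpk Uk) 1 := by
    rw [hXw, map_add, map_smul, ω.compatible h0, Complex.add_re, smul_eq_mul, Complex.re_ofReal_mul]
    rfl
  rwa [hre] at h


/-! ### §3 The `D₄`-reduced form: the rotated energy observable, and orbit-mean sourced cuts

Point-group-reduced relaxations (labels `γₗ ∈ S ⊆ D₄` on the symmetry family) certify the
`S`-ORBIT MEAN of the objective (`IsTorusLimitOf.re_sum_expect_d4_ge_of_window_certificate_TT'_ineq`).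
For the sourced objective `V•W + Γ E_{Φ(θ_k)}` the energy part is the same on every rotated copy —
`Re ω_{γΛ'}(Γ(d4Emb γ 0) Γ E_{Φ(θ)}) = e_{Φ(θ)}(ω)` for every torus limit `ω` and every `γ ∈ D₄`
(`IsTorusLimitOf.re_expect_d4Emb_meanEnergyObs`: on each large torus the averaged expectation of the
rotated energy observable is again `⟨ψ, H^{tt'}_L(θ) ψ⟩/L²`, because the torus `D₄` unitaries normalise
the translation group and commute with `H^{tt'}_L(θ)`, `relabel_d4Perm_hubbardTorusTT'`) — so a
`D₄`-reduced eom-free sourced certificate feeds the sourced cut with the ORBIT-MEAN word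
`w̄ = |S|⁻¹ Σ_{γ∈S} Re ω_{γΛ'}(Γ(d4Emb γ 0) W)` (`IsTorusLimitOf.sourcedCut_of_window_certificate_d4_TT'_ineq`;
§2 is the case `S = {1}`). -/

section D4Torus

variable {L : ℕ} [NeZero L]

/-- `D_γ T_u = T_{-v} D_γ`-bookkeeping: `T_{-v} ∘ D_γ = D_γ ∘ T_{γ⁻¹(-v)}` as relabellings of a torus
operator. [cite: Han2020Bootstrap, §3] -/
theorem relabel_translate_neg_relabel_d4Perm (γ : DihedralGroup 4) (v : TorusSite 2 L)
    (X : Matrix (Finset (Orb (FermionTorus 2 L))) (Finset (Orb (FermionTorus 2 L))) ℂ) :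
    relabel (Orb.translate (-v)) (relabel (Orb.d4Perm γ) X) =
      relabel (Orb.d4Perm γ) (relabel (Orb.translate (d4Site γ⁻¹ (-v))) X) := by
  rw [← relabel_trans, ← relabel_trans, ← Equiv.Perm.mul_def, ← Equiv.Perm.mul_def,
    Orb.d4Perm_mul_translate, d4Site_apply_inv]

/-- **The averaged torus expectation of a ROTATED energy observable is the energy per site.** For
`L ≥ 3`, a window `Λ' ⊇ thicken {0} 1` with `x ↦ x mod L` injective on `Λ'` and on `γΛ'`, and any torus
vector `ψ`: the translation average of `Γ(ι_{γΛ'}) Γ(d4Emb γ 0) Γ(incl) E^{tt'}_Φ` in `ψ` is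
`⟨ψ, H^{tt'}_L ψ⟩/L²` — the pull-back is `D_γ (Γ(ι) E_Φ) D_γᴴ` (`fermionEmbed_toTorusEmb_d4Emb`),
`D_γ T_u = T_{γu} D_γ` (`Orb.d4Perm_mul_translate`), the translates of `Γ(ι) E_Φ` sum to `H^{tt'}_L`
(`sum_relabel_translate_hubbardTTPrime_meanEnergyObs`) and `D_γ H^{tt'}_L D_γᴴ = H^{tt'}_L`
(`relabel_d4Perm_hubbardTorusTT'`). [cite: Han2020Bootstrap, §3] -/
theorem torusAvgExpect_d4Emb_hubbardTTPrime_meanEnergyObs (t t' U : ℝ) (γ : DihedralGroup 4)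
    (hL : 3 ≤ L) {Λ' : Finset (Site 2)} (h0 : thicken ({0} : Finset (Site 2)) 1 ⊆ Λ')
    (hInj' : Set.InjOn (Torus.proj (d := 2) L) ↑Λ')
    (hInjg : Set.InjOn (Torus.proj (d := 2) L) ↑(d4ShiftSet γ 0 Λ'))
    (ψ : Fock (Orb (FermionTorus 2 L))) :
    torusAvgExpect L (d4ShiftSet γ 0 Λ')
        (fermionEmbed (PolySite.d4Emb γ 0 Λ')
          (fermionEmbed (PolySite.incl h0) ((hubbardTTPrimeFermionInteraction t t' U).meanEnergyObs 1))) ψ =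
      QuantumLattice.expect (hubbardTorusTT' L t t' U) ψ / ((L : ℂ) ^ 2) := by
  have hT : Set.InjOn (Torus.proj (d := 2) L) ↑(thicken ({0} : Finset (Site 2)) 1) :=
    injOn_proj_thicken_one (d := 2) hL
  have hcard : Fintype.card (TorusSite 2 L) = L ^ 2 := by simp [ZMod.card, Fintype.card_fin]
  have hproj0 : Torus.proj L (0 : Site 2) = 0 := by funext i; simp [Torus.proj]
  have hrot : fermionEmbed (PolySite.toTorusEmb L hInjg)
      (fermionEmbed (PolySite.d4Emb γ 0 Λ')
        (fermionEmbed (PolySite.incl h0) ((hubbardTTPrimeFermionInteraction t t' U).meanEnergyObs 1))) =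
      relabel (Orb.d4Perm γ)
        (fermionEmbed (PolySite.toTorusEmb L hT) ((hubbardTTPrimeFermionInteraction t t' U).meanEnergyObs 1)) := by
    rw [fermionEmbed_toTorusEmb_d4Emb γ 0 hInj' hInjg, fermionEmbed_toTorusEmb_incl h0 hInj', hproj0,
      Orb.translate_zero, Equiv.Perm.one_def, relabel_refl]
  rw [torusAvgExpect_eq, torusAvgExpectAt_of_injOn L hInjg, hcard, Nat.cast_pow, div_eq_inv_mul, hrot]
  congr 1
  have hstep : ∀ v : TorusSite 2 L,
      QuantumLattice.expect (relabel (Orb.d4Perm γ)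
          (fermionEmbed (PolySite.toTorusEmb L hT) ((hubbardTTPrimeFermionInteraction t t' U).meanEnergyObs 1)))
          ((fockTranslate v).val *ᵥ ψ) =
        QuantumLattice.expect (relabel (Orb.d4Perm γ) (relabel (Orb.translate (d4Site γ⁻¹ (-v)))
          (fermionEmbed (PolySite.toTorusEmb L hT) ((hubbardTTPrimeFermionInteraction t t' U).meanEnergyObs 1)))) ψ := by
    intro v
    rw [expect_fockRelabel_mulVec, ← Equiv.Perm.inv_def, ← Orb.translate_neg, relabel_translate_neg_relabel_d4Perm]
  simp_rw [hstep]
  rw [Fintype.sum_equiv ((Equiv.neg (TorusSite 2 L)).trans (d4SitePerm (L := L) γ⁻¹))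
      (fun v => QuantumLattice.expect (relabel (Orb.d4Perm γ) (relabel (Orb.translate (d4Site γ⁻¹ (-v)))
        (fermionEmbed (PolySite.toTorusEmb L hT) ((hubbardTTPrimeFermionInteraction t t' U).meanEnergyObs 1)))) ψ)
      (fun u => QuantumLattice.expect (relabel (Orb.d4Perm γ) (relabel (Orb.translate u)
        (fermionEmbed (PolySite.toTorusEmb L hT) ((hubbardTTPrimeFermionInteraction t t' U).meanEnergyObs 1)))) ψ)
      (fun v => rfl)]
  have hsum : ∀ f : TorusSite 2 L → Matrix (Finset (Orb (FermionTorus 2 L))) (Finset (Orb (FermionTorus 2 L))) ℂ,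
      ∑ u, QuantumLattice.expect (f u) ψ = QuantumLattice.expect (∑ u, f u) ψ := by
    intro f
    rw [QuantumLattice.expect, Matrix.sum_mulVec, dotProduct_sum]
    rfl
  rw [hsum, ← relabel_sum, sum_relabel_translate_hubbardTTPrime_meanEnergyObs (L := L) (t' := t') t U hL,
    relabel_d4Perm_hubbardTorusTT']

end D4Torus

/-- **The rotated energy observable has the same value as the energy observable in every torus
limit**: for `ω` a torus limit along `Ls → ∞` (of any torus vectors), every `γ ∈ D₄` and every window
`Λ' ⊇ thicken {0} 1`, `Re ω_{γΛ'}(Γ(d4Emb γ 0) Γ(incl) E^{tt'}_{Φ(t,t',U)}) = e_{Φ(t,t',U)}(ω)` (both are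
limits of `⟨ψ_j, H^{tt'}_{Ls j} ψ_j⟩/(Ls j)²`, `torusAvgExpect_d4Emb_hubbardTTPrime_meanEnergyObs`,
`torusAvgExpect_hubbardTTPrime_meanEnergyObs`). [cite: BratteliKishimotoRobinson1978, §3 (mean energy functional)] -/
theorem IsTorusLimitOf.re_expect_d4Emb_meanEnergyObs (t t' U : ℝ) (γ : DihedralGroup 4)
    {Λ' : Finset (Site 2)} (h0 : thicken ({0} : Finset (Site 2)) 1 ⊆ Λ')
    {ω : InfVolFermionState 2} {ψ : ∀ L, Fock (Orb (FermionTorus 2 L))} {Ls : ℕ → ℕ}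
    (hω : ω.IsTorusLimitOf ψ Ls) (hLs : Tendsto Ls atTop atTop) :
    (ω.expect (d4ShiftSet γ 0 Λ') (fermionEmbed (PolySite.d4Emb γ 0 Λ')
        (fermionEmbed (PolySite.incl h0) ((hubbardTTPrimeFermionInteraction t t' U).meanEnergyObs 1)))).re =
      ω.meanEnergy (hubbardTTPrimeFermionInteraction t t' U) 1 := by
  have hrot := hω (d4ShiftSet γ 0 Λ') (fermionEmbed (PolySite.d4Emb γ 0 Λ')
    (fermionEmbed (PolySite.incl h0) ((hubbardTTPrimeFermionInteraction t t' U).meanEnergyObs 1)))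
  have hE := hω (thicken ({0} : Finset (Site 2)) 1) ((hubbardTTPrimeFermionInteraction t t' U).meanEnergyObs 1)
  have heq : ∀ᶠ j in atTop,
      torusAvgExpect (Ls j) (thicken ({0} : Finset (Site 2)) 1)
          ((hubbardTTPrimeFermionInteraction t t' U).meanEnergyObs 1) (ψ (Ls j)) =
        torusAvgExpect (Ls j) (d4ShiftSet γ 0 Λ') (fermionEmbed (PolySite.d4Emb γ 0 Λ')
          (fermionEmbed (PolySite.incl h0) ((hubbardTTPrimeFermionInteraction t t' U).meanEnergyObs 1)))
          (ψ (Ls j)) := by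
    filter_upwards [eventually_injOn_proj_of_tendsto Λ' hLs,
      eventually_injOn_proj_of_tendsto (d4ShiftSet γ 0 Λ') hLs, hLs.eventually_ge_atTop 3] with j h1 h2 h3
    haveI : NeZero (Ls j) := ⟨by omega⟩
    rw [torusAvgExpect_d4Emb_hubbardTTPrime_meanEnergyObs t t' U γ h3 h0 h1 h2,
      torusAvgExpect_hubbardTTPrime_meanEnergyObs t t' U h3]
  have hlim : ω.expect (d4ShiftSet γ 0 Λ') (fermionEmbed (PolySite.d4Emb γ 0 Λ')
        (fermionEmbed (PolySite.incl h0) ((hubbardTTPrimeFermionInteraction t t' U).meanEnergyObs 1))) =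
      ω.expect (thicken ({0} : Finset (Site 2)) 1) ((hubbardTTPrimeFermionInteraction t t' U).meanEnergyObs 1) :=
    tendsto_nhds_unique hrot (hE.congr' heq)
  rw [hlim]
  rfl

/-- **`D₄`-reduced eom-free sourced window certificate ⇒ orbit-mean sourced cut for the query state.**
Data as in `sourcedCut_of_window_certificate_TT'_ineq` (§2) but with point-group labels `γₗ ∈ S` on the
symmetry family (`S ∋ 1` closed under multiplication, e.g. `S = D₄`): the identity in `𝔄_{Λ'}`
`(V•W + Γ E_{Φ(t,t'ₖ,Uₖ)}) − c·1 − Σ_σ μ_σ (n_{0σ} − ν) = Σ Λmᵢⱼ Oᵢ⋆Oⱼ + Σₗ (Γ(incl)(Γ(d4Emb γₗ wₗ) Yₗ) − Γ(incl) Yₗ)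
  + (charged words) + Σ d (Vᴴ − V) + Σ aₖ vₖ`, `Λm ⪰ 0`, NO eom rows, NO cap. Then for every torus limit `ω`
along `Ls → ∞` of unit `(rectN n (Ls j), S^z = 0)` sector ground states of `hubbardTorusTT' (Ls j) t t' U`
(`U ≥ 0`, `0 ≤ n < 2`, any query coupling):
`c − Σₖ‖aₖ‖ + (Σ_σ μ_σ)(n/2 − ν) ≤ V · w̄ + e_{Φ(t,t'ₖ,Uₖ)}(ω)`,
`w̄ = |S|⁻¹ Σ_{γ∈S} Re ω_{γΛ'}(Γ(d4Emb γ 0) W)` the `S`-orbit mean of the word — the hypothesis `hcutW`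
of `capCutsWord_dual_le` for the orbit-mean word coordinate. (`…re_sum_expect_d4_ge_of_window_certificate_TT'_ineq`
with `s = ∅`, `κ = 0`, and `IsTorusLimitOf.re_expect_d4Emb_meanEnergyObs` on the energy part of each
rotated copy.) [cite: WangEtAl2024, §III] [cite: Han2020Bootstrap, §3] -/
theorem IsTorusLimitOf.sourcedCut_of_window_certificate_d4_TT'_ineq
    (t t' : ℝ) {U : ℝ} (hU : 0 ≤ U) {n : ℝ} (hn0 : 0 ≤ n) (hn2 : n < 2) (tpk Uk V : ℝ)
    {Λ Λ' : Finset (Site 2)} (hΛ : Λ ⊆ Λ') (h8 : thicken Λ 1 ⊆ Λ')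
    (h0 : thicken ({0} : Finset (Site 2)) 1 ⊆ Λ') (hz : (0 : Site 2) ∈ Λ')
    {S : Finset (DihedralGroup 4)} (h1 : (1 : DihedralGroup 4) ∈ S) (hmul : ∀ a ∈ S, ∀ b ∈ S, a * b ∈ S)
    (W : FermionOp Λ') (μ : Fin 2 → ℝ) (ν : ℝ)
    {m : Type*} [Fintype m] [DecidableEq m] {Λm : Matrix m m ℂ} (hΛm : Λm.PosSemidef)
    (O : m → FermionOp Λ')
    {ι : Type*} (tt : Finset ι) (γ : ι → DihedralGroup 4) (hγS : ∀ l ∈ tt, γ l ∈ S) (wv : ι → Site 2)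
    (hsh : ∀ l, d4ShiftSet (γ l) (wv l) Λ ⊆ Λ') (Y : ι → FermionOp Λ)
    {ρ : Type*} (uu : Finset ρ) (b : ρ → ℂ) (cw : ρ → List (Orb (PolySite Λ') × Bool))
    (hcw : ∀ j ∈ uu, ladderCharge (cw j) ≠ 0 ∨ ladderSpinCharge (cw j) ≠ 0)
    {δ : Type*} (ah : Finset δ) (dc : δ → ℝ) (Vh : δ → FermionOp Λ')
    {κ'' : Type*} (w : Finset κ'') (a : κ'' → ℂ) (word : κ'' → List (Orb (PolySite Λ') × Bool)) {c : ℝ}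
    (hcert : (((V : ℝ) : ℂ) • W +
          fermionEmbed (PolySite.incl h0) ((hubbardTTPrimeFermionInteraction t tpk Uk).meanEnergyObs 1)) -
        (c : ℂ) • (1 : FermionOp Λ') -
        ∑ σ : Fin 2, ((μ σ : ℝ) : ℂ) • (nAt 0 hz σ - ((ν : ℝ) : ℂ) • (1 : FermionOp Λ')) =
      gramForm Λm O +
        (∑ l ∈ tt, (fermionEmbed (PolySite.incl (hsh l))
            (fermionEmbed (PolySite.d4Emb (γ l) (wv l) Λ) (Y l)) -
            fermionEmbed (PolySite.incl hΛ) (Y l)) +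
          ∑ j ∈ uu, b j • ladderWord (cw j)) +
        (∑ m' ∈ ah, ((dc m' : ℝ) : ℂ) • ((Vh m')ᴴ - Vh m') + ∑ k ∈ w, a k • ladderWord (word k)))
    {Ls : ℕ → ℕ} (hLs : Tendsto Ls atTop atTop)
    {ψ : ∀ L, Fock (Orb (FermionTorus 2 L))}
    (hψ : ∀ j, IsGroundStateInSector (hubbardTorusTT' (Ls j) t t' U)
      (ThermodynamicLimit.rectN n (Ls j)) 0 (ψ (Ls j)))
    (hψ1 : ∀ j, star (ψ (Ls j)) ⬝ᵥ ψ (Ls j) = 1)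
    {ω : InfVolFermionState 2} (hω : ω.IsTorusLimitOf ψ Ls) :
    c - ∑ k ∈ w, ‖a k‖ + (∑ σ : Fin 2, μ σ) * (n / 2 - ν) ≤
      V * ((S.card : ℝ)⁻¹ * ∑ g ∈ S,
          (ω.expect (d4ShiftSet g 0 Λ') (fermionEmbed (PolySite.d4Emb g 0 Λ') W)).re) +
        ω.meanEnergy (hubbardTTPrimeFermionInteraction t tpk Uk) 1 := by
  set Xw : FermionOp Λ' := ((V : ℝ) : ℂ) • W +
    fermionEmbed (PolySite.incl h0) ((hubbardTTPrimeFermionInteraction t tpk Uk).meanEnergyObs 1) with hXw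
  -- the same identity in the shape of the tree theorem: empty eom family, `κ = 0`, cap `u := e`
  have hcert' : Xw - (c : ℂ) • (1 : FermionOp Λ') -
      ∑ σ : Fin 2, ((μ σ : ℝ) : ℂ) • (nAt 0 hz σ - ((ν : ℝ) : ℂ) • (1 : FermionOp Λ')) -
      (((0 : ℝ) : ℝ) : ℂ) • ((((ThermodynamicLimit.energyDensityTT' t t' U n : ℝ)) : ℂ) • (1 : FermionOp Λ') -
        fermionEmbed (PolySite.incl h0) ((hubbardTTPrimeFermionInteraction t t' U).meanEnergyObs 1)) =
      gramForm Λm O +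
        (∑ k ∈ (∅ : Finset Unit), ((hubbardTTPrimeFermionInteraction t t' U).localHamiltonian Λ' *
            fermionEmbed (PolySite.incl hΛ) ((fun _ : Unit => (0 : FermionOp Λ)) k) -
            fermionEmbed (PolySite.incl hΛ) ((fun _ : Unit => (0 : FermionOp Λ)) k) *
              (hubbardTTPrimeFermionInteraction t t' U).localHamiltonian Λ') +
          ∑ l ∈ tt, (fermionEmbed (PolySite.incl (hsh l))
            (fermionEmbed (PolySite.d4Emb (γ l) (wv l) Λ) (Y l)) -
            fermionEmbed (PolySite.incl hΛ) (Y l)) +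
          ∑ j ∈ uu, b j • ladderWord (cw j)) +
        (∑ m' ∈ ah, ((dc m' : ℝ) : ℂ) • ((Vh m')ᴴ - Vh m') + ∑ k ∈ w, a k • ladderWord (word k)) := by
    rw [Finset.sum_empty, zero_add, Complex.ofReal_zero, zero_smul, sub_zero]
    exact hcert
  have h := hω.re_sum_expect_d4_ge_of_window_certificate_TT'_ineq t t' hU hn0 hn2 (le_refl (0 : ℝ))
    (le_refl (ThermodynamicLimit.energyDensityTT' t t' U n)) hΛ h8 h0 hz h1 hmul Xw μ ν hΛm O
    (∅ : Finset Unit) (fun _ : Unit => (0 : FermionOp Λ)) tt γ hγS wv hsh Y uu b cw hcw ah dc Vh w a word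
    hcert' hLs hψ hψ1
  -- read each rotated copy of the objective: `Re ω(Γ_g(V•W + Γ E)) = V·Re ω(Γ_g W) + e_Φ(ω)`
  have hterm : ∀ g ∈ S, (ω.expect (d4ShiftSet g 0 Λ') (fermionEmbed (PolySite.d4Emb g 0 Λ') Xw)).re =
      V * (ω.expect (d4ShiftSet g 0 Λ') (fermionEmbed (PolySite.d4Emb g 0 Λ') W)).re +
        ω.meanEnergy (hubbardTTPrimeFermionInteraction t tpk Uk) 1 := by
    intro g _
    rw [hXw, map_add, map_smul, map_add, map_smul, Complex.add_re, smul_eq_mul, Complex.re_ofReal_mul,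
      hω.re_expect_d4Emb_meanEnergyObs t tpk Uk g h0 hLs]
  rw [Finset.sum_congr rfl hterm, Finset.sum_add_distrib, Finset.sum_const, ← Finset.mul_sum,
    nsmul_eq_mul] at h
  have hcard : (S.card : ℝ) ≠ 0 := by exact_mod_cast (Finset.card_pos.2 ⟨1, h1⟩).ne'
  have hsplit : (S.card : ℝ)⁻¹ * (V * ∑ g ∈ S,
      (ω.expect (d4ShiftSet g 0 Λ') (fermionEmbed (PolySite.d4Emb g 0 Λ') W)).re +
        (S.card : ℝ) * ω.meanEnergy (hubbardTTPrimeFermionInteraction t tpk Uk) 1) =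
      V * ((S.card : ℝ)⁻¹ * ∑ g ∈ S,
        (ω.expect (d4ShiftSet g 0 Λ') (fermionEmbed (PolySite.d4Emb g 0 Λ') W)).re) +
        ω.meanEnergy (hubbardTTPrimeFermionInteraction t tpk Uk) 1 := by
    field_simp
  rwa [hsplit] at h

/-! ### §4 Two-sided barycentric sourcing (planner-p1 RULING R-12 (1), sketch "L-10"; every state
satisfying the cap and the sourced cuts — the ground-state content enters only through §2–§3's feeding) -/

/-- **Lower half**: sourced cuts with source `+V₀` at the corners, cap at the barycentre
⇒ `(Σ w_k ℓ⁺_k − u*)/V₀ ≤ w`. [cite: KomaTasaki1994, §1]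
[cite: Bertsekas1999NonlinearProgramming, Prop. 5.1.3] -/
theorem word_ge_of_sourcedCuts_barycentric (ω : InfVolFermionState 2) (t : ℝ) {ι : Type*}
    (B : Finset ι) (tpW UcW loP wgt : ι → ℝ) (hwgt : ∀ k ∈ B, 0 ≤ wgt k)
    (hsum : ∑ k ∈ B, wgt k = 1) {V₀ : ℝ} (hV : 0 < V₀) (w : ℝ)
    (hcutP : ∀ k ∈ B,
      loP k ≤ ω.meanEnergy (hubbardTTPrimeFermionInteraction t (tpW k) (UcW k)) 1 + V₀ * w)
    {u t' U : ℝ} (hcap : ω.meanEnergy (hubbardTTPrimeFermionInteraction t t' U) 1 ≤ u)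
    (hbt : ∑ k ∈ B, wgt k * tpW k = t') (hbU : ∑ k ∈ B, wgt k * UcW k = U) :
    (∑ k ∈ B, wgt k * loP k - u) / V₀ ≤ w := by
  have h := ω.word_bound_of_capCutsWord t (∅ : Finset Unit) (fun _ => 0) (fun _ => 0) (fun _ => 0)
    (fun _ => 0) (fun _ h => absurd h (Finset.notMem_empty _))
    (fun _ h => absurd h (Finset.notMem_empty _)) B tpW UcW (fun _ => V₀) loP wgt hwgt w
    (by intro k hk; simpa using hcutP k hk) (le_of_lt one_pos) hcap
    (by rw [Finset.sum_empty, ← Finset.sum_mul, hsum]; ring)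
    (by rw [Finset.sum_empty, hbt]; ring)
    (by rw [Finset.sum_empty, hbU]; ring)
  rw [Finset.sum_empty, ← Finset.sum_mul, hsum] at h
  rw [div_le_iff₀ hV]
  linarith

/-- **Upper half**: sourced cuts with source `−V₀` at the corners, cap at the barycentre
⇒ `w ≤ (u* − Σ w_k ℓ⁻_k)/V₀`. [cite: KomaTasaki1994, §1]
[cite: Bertsekas1999NonlinearProgramming, Prop. 5.1.3] -/
theorem word_le_of_sourcedCuts_barycentric (ω : InfVolFermionState 2) (t : ℝ) {ι : Type*}
    (B : Finset ι) (tpW UcW loM wgt : ι → ℝ) (hwgt : ∀ k ∈ B, 0 ≤ wgt k)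
    (hsum : ∑ k ∈ B, wgt k = 1) {V₀ : ℝ} (hV : 0 < V₀) (w : ℝ)
    (hcutM : ∀ k ∈ B,
      loM k ≤ ω.meanEnergy (hubbardTTPrimeFermionInteraction t (tpW k) (UcW k)) 1 - V₀ * w)
    {u t' U : ℝ} (hcap : ω.meanEnergy (hubbardTTPrimeFermionInteraction t t' U) 1 ≤ u)
    (hbt : ∑ k ∈ B, wgt k * tpW k = t') (hbU : ∑ k ∈ B, wgt k * UcW k = U) :
    w ≤ (u - ∑ k ∈ B, wgt k * loM k) / V₀ := by
  have h := ω.word_bound_of_capCutsWord t (∅ : Finset Unit) (fun _ => 0) (fun _ => 0) (fun _ => 0)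
    (fun _ => 0) (fun _ h => absurd h (Finset.notMem_empty _))
    (fun _ h => absurd h (Finset.notMem_empty _)) B tpW UcW (fun _ => -V₀) loM wgt hwgt w
    (by intro k hk; have := hcutM k hk; linarith) (le_of_lt one_pos) hcap
    (by rw [Finset.sum_empty, ← Finset.sum_mul, hsum]; ring)
    (by rw [Finset.sum_empty, hbt]; ring)
    (by rw [Finset.sum_empty, hbU]; ring)
  rw [Finset.sum_empty, ← Finset.sum_mul, hsum] at h
  rw [le_div_iff₀ hV]
  linarith

/-- **Both halves at once** (the R-12 bracket): `w ∈ [(Σ w_k ℓ⁺_k − u*)/V₀, (u* − Σ w_k ℓ⁻_k)/V₀]`.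
[cite: KomaTasaki1994, §1] [cite: Bertsekas1999NonlinearProgramming, Prop. 5.1.3] -/
theorem word_mem_Icc_of_sourcedCuts_barycentric (ω : InfVolFermionState 2) (t : ℝ) {ι : Type*}
    (B : Finset ι) (tpW UcW loP loM wgt : ι → ℝ) (hwgt : ∀ k ∈ B, 0 ≤ wgt k)
    (hsum : ∑ k ∈ B, wgt k = 1) {V₀ : ℝ} (hV : 0 < V₀) (w : ℝ)
    (hcutP : ∀ k ∈ B,
      loP k ≤ ω.meanEnergy (hubbardTTPrimeFermionInteraction t (tpW k) (UcW k)) 1 + V₀ * w)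
    (hcutM : ∀ k ∈ B,
      loM k ≤ ω.meanEnergy (hubbardTTPrimeFermionInteraction t (tpW k) (UcW k)) 1 - V₀ * w)
    {u t' U : ℝ} (hcap : ω.meanEnergy (hubbardTTPrimeFermionInteraction t t' U) 1 ≤ u)
    (hbt : ∑ k ∈ B, wgt k * tpW k = t') (hbU : ∑ k ∈ B, wgt k * UcW k = U) :
    w ∈ Set.Icc ((∑ k ∈ B, wgt k * loP k - u) / V₀) ((u - ∑ k ∈ B, wgt k * loM k) / V₀) :=
  ⟨ω.word_ge_of_sourcedCuts_barycentric t B tpW UcW loP wgt hwgt hsum hV w hcutP hcap hbt hbU,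
   ω.word_le_of_sourcedCuts_barycentric t B tpW UcW loM wgt hwgt hsum hV w hcutM hcap hbt hbU⟩

end InfVolFermionState

/-! ### §5 The exact cap-defect identity and its sign under ONE concave (min-of-affine) majorant
(pure bookkeeping over `ℝ`; sketch "L-10" §2–§3) -/

/-- (interior two-sided width) − Σ_k w_k (corner `k`'s own two-sided width, cap `u_k`)
`= 2(u* − Σ_k w_k u_k)/V₀`: the sourced certificates `ℓ^±_k` cancel; the price of transport is the
cap defect alone (R-12 (1); an elementary identity between the weak-duality brackets of §4 at the
barycentre and at the corners). [cite: Bertsekas1999NonlinearProgramming, Prop. 5.1.3] -/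
theorem twoSided_width_sub_mean_corner_width {ι : Type*} (B : Finset ι)
    (loP loM uk wgt : ι → ℝ) (u V₀ : ℝ) :
    ((u - ∑ k ∈ B, wgt k * loM k) / V₀ - (∑ k ∈ B, wgt k * loP k - u) / V₀) -
        ∑ k ∈ B, wgt k * ((uk k - loM k) / V₀ - (loP k - uk k) / V₀) =
      2 * (u - ∑ k ∈ B, wgt k * uk k) / V₀ := by
  have h1 : ∑ k ∈ B, wgt k * ((uk k - loM k) / V₀ - (loP k - uk k) / V₀) =
      (∑ k ∈ B, (2 * (wgt k * uk k) - wgt k * loM k - wgt k * loP k)) / V₀ := by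
    rw [Finset.sum_div]
    exact Finset.sum_congr rfl fun k _ => by ring
  rw [h1, Finset.sum_sub_distrib, Finset.sum_sub_distrib, ← Finset.mul_sum]
  ring

/-- If every cap is the value of the same pointwise minimum of finitely many affine functions of the
couplings — `u_k = min_p (α_p + β_p t'_k + γ_p U_k)`, `u* = min_p (α_p + β_p t' + γ_p U)` — and
`(t', U)` is the `wgt`-barycentre of the corners, then `Σ_k w_k u_k ≤ u*` (a minimum of affine maps
is concave), i.e. the cap defect of `twoSided_width_sub_mean_corner_width` is nonnegative.
[cite: Bertsekas1999NonlinearProgramming, Prop. B.2(d)] -/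
theorem sum_wgt_inf'_affine_le_inf'_affine_barycentre {ι π : Type*} (B : Finset ι)
    (P : Finset π) (hP : P.Nonempty) (α β γ : π → ℝ) (tpW UcW wgt : ι → ℝ)
    (hwgt : ∀ k ∈ B, 0 ≤ wgt k) (hsum : ∑ k ∈ B, wgt k = 1) {t' U : ℝ}
    (hbt : ∑ k ∈ B, wgt k * tpW k = t') (hbU : ∑ k ∈ B, wgt k * UcW k = U) :
    ∑ k ∈ B, wgt k * P.inf' hP (fun p => α p + β p * tpW k + γ p * UcW k) ≤
      P.inf' hP (fun p => α p + β p * t' + γ p * U) := by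
  obtain ⟨q, hq, hqeq⟩ := Finset.exists_mem_eq_inf' hP (fun p => α p + β p * t' + γ p * U)
  rw [hqeq]
  have hcorner : ∀ k ∈ B, wgt k * P.inf' hP (fun p => α p + β p * tpW k + γ p * UcW k) ≤
      wgt k * (α q + β q * tpW k + γ q * UcW k) := fun k hk =>
    mul_le_mul_of_nonneg_left (Finset.inf'_le _ hq) (hwgt k hk)
  calc ∑ k ∈ B, wgt k * P.inf' hP (fun p => α p + β p * tpW k + γ p * UcW k)
      ≤ ∑ k ∈ B, wgt k * (α q + β q * tpW k + γ q * UcW k) := Finset.sum_le_sum hcorner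
    _ = α q * ∑ k ∈ B, wgt k + β q * ∑ k ∈ B, wgt k * tpW k + γ q * ∑ k ∈ B, wgt k * UcW k := by
        rw [Finset.mul_sum, Finset.mul_sum, Finset.mul_sum, ← Finset.sum_add_distrib,
          ← Finset.sum_add_distrib]
        exact Finset.sum_congr rfl fun k _ => by ring
    _ = α q + β q * t' + γ q * U := by rw [hsum, hbt, hbU, mul_one]

end Literature.MathematicalPhysics.QuantumLattice
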